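import Summits.ABC.IUTFork.Repair.CandLana1
import Summits.ABC.IUTFork.Cor312ThetaSidePerImageK
import Summits.ABC.IUTFork.Cor312PinnedHonestReal
import HarnessLib

/-!
# REPAIR-CATALOGUE row R-LANA (RC-130) — Project LANA's (9-1) AS TYPED (`Repair.CandLana1.H`) EVALUATED AT THE GENUINE BED:
# FALSE at abc-iut-c312-7's print-normalised SHARP real setting with Θ- and q-ideles realising `P_Θ`, `P_q` (D-0123 (C); KEY RLANA,
# seat abc-iut-rcat-tst-9; «identification family already refuted on data?» — the kernel form of the answer for OUR typing)

PROOF-ONLY file (D-0012; no definition, no `Prop` fact; class `Lana`, rows RP-L01 / RC-130; rung LADDER-ABC:A2). TAKES NO SIDE on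
[IUTchIII] Cor. 3.12 / [IUTchIV] Thm. 1.10, on the LANA authors, or on any author; nothing here asserts abc proved or refuted; REFUTED-AS-TYPED ≠
refuted-in-print. Source of the row: Project LANA interim report `paper:url-7e4c7f9f3efc` §9.2 (9-1) p. 46 («we wish to show that there exists
some suitable S such that η_q = η^anab_S»), typed by abc-iut-w5-d182 as `Repair.CandLana1.H` = «SOME global possible image of the Θ-pilot object
(one ⟨(Ind1) ∪ (Ind2)⟩-translate of the (Ind3)-enlarged Kummer image in every packet `(j, v_ℚ)`, `j ∈ 𝔽_l^⋇`) has procession-normalised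
mono-analytic log-volume EQUAL to `−|log(q)|`» (= abc-iut-c312-4's `EtaSetting.MainGoal`, `CandLana1.H_iff_mainGoal`).

WHAT IS PROVED (`not_H_settingPrVolSharp`). At abc-iut-c312-7's print-normalised assembled real setting `Thm311.Real.settingPrVolSharp X …` over
abc-iut-c312-5's real lattice situation `Thm311.LatticeSituation.ofShells (logShellsDH X logv) …` (the data of the genuine-setting certificates
of branch C, e.g. `Conditional/AbcOfSShrink1.lean`; ANY pilot data `X` over any number field), for Θ-ideles `t` realising `P_Θ` and q-ideles
`tq` realising `P_q` in Dupuy–Hilado's normalisation (3.4) (c312-7's closed-form hypotheses `ht`, `htq`; inhabited by abc-iut-c312-3's realising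
ideles whenever `2l ∣ ord_v(q_v)` on the support, `exists_ideles_settingPrVolSharp`), the typed (9-1) `CandLana1.H` FAILS for EVERY region
reading `ρ` and q-datum `qK`. The proof is two landed theorems: abc-iut-s2-p9's `Thm311.Real.processionNormalized_imageChoice_settingPrVolSharp`
(EVERY global possible image has procession-normalised volume `−deĝ̲_lgp(P_Θ)`: (Ind1)/(Ind2) act through volume-preserving maps —
[IUTchIII] proof of Cor. 3.12 Step (x) p. 181 «the resulting log-volumes … are invariant with respect to the indeterminacies (Ind1), (Ind2)» —
and the sharp boxes do not depend on the lattice position) and abc-iut-c312-7's `negLogQ_settingPrVolSharp` (`−|log(q)| = −deĝ̲(P_q)`) with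
`neg_ndegLgp_thetaPilot_lt_neg_ndeg_qPilot` (`−deĝ̲_lgp(P_Θ) < −deĝ̲(P_q)`, Dupuy–Hilado Thm. 3.10.1: `P_Θ = ((ℓ⋇+1)(2ℓ⋇+1)/6)·P_q`, `deĝ̲(P_q) > 0`).
So at this bed the set of procession-normalised volumes of the global possible images is the SINGLETON `{−deĝ̲_lgp(P_Θ)}` and misses `−|log(q)|`:
in OUR typing the «∃ suitable S» of (9-1) has no freedom at the level of volume classes.

READING (numbers, not adjectives; no side). For the REPAIR-CATALOGUE's kernel_close cell of row R-LANA: the identification family AT THE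
GLOBAL-LINE GRAIN (the located grain of (9-1), abc-iut-rcat-tst-6 07:06:47Z) is KILLED AS TYPED at the genuine sharp bed with realising ideles —
the genuine-bed twin of the toy-model kill `CandLana1.not_H_pinned` (CM). HONEST SCOPE: (a) a statement about OUR typed objects — c312-7's sharp
setting absorbs (Ind3) into the sharp boxes and realises (Ind1)/(Ind2) by volume-preserving maps (Dupuy–Hilado's reading), so possible-image
volumes never move; LANA's «suitable S … integral-structure data inside the product of log-shells» (§10.3 p. 48 l. 18–19) may be read more
flexibly in print, and (9-1) is the report's self-declared OPEN GOAL (§10.5 p. 49) — refuted-as-typed ≠ refuted-in-print; (b) the realising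
hypotheses `ht`, `htq` are those of every genuine-bed record of the cell (p426498, p430714); at F-level pilot data OF an initial Θ-datum they are
not satisfiable ([IUTchI] Def. 3.1 (c) as typed, `SideVacuity.not_realising_qIdeles_of_isPilotDataOf`), over `K` they are (`GenuineK`); (c) the
weaker SUMMED reading survives: the typed Corollary (`−|log(q)| ≤ −|log(Θ)|`, hull volumes) is a THEOREM at this bed on the inhabited bands
(reading (U), `Conditional.…cor312Of…`), so what fails is the EQUALITY with a possible-image volume, not the inequality with the hull.
[cite: LANA2026Report, §9.2 (9-1) p. 46; §10.3 p. 48; §10.5 p. 49] [cite: Mochizuki2012, IUTchIII Cor. 3.12 p. 173–174; proof Step (x) p. 181]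
[cite: DupuyHilado2025, §3.3, §3.4, Thm. 3.10.1] [claim: Mochizuki2012, status: disputed] for every quoted construction.
-/

noncomputable section

open Set Function NumberField IsDedekindDomain

namespace Summit.ABC.IUTFork.Repair.RLana91GenuineBed

open Thm311 Thm311.Real Cor312 Cor312Vol Literature.IUT.LogThetaLattice Literature.IUT.LogVolume Literature.IUT.HodgeTheaters
  Literature.NumberTheory.NumberFields

variable {F : Type} [Field F] [NumberField F] (X : PilotData F) {logv : PadicLogs F} (hlog : LogvAnalytic logv)
  (M : Type) [Field M] [NumberField M]
  (archPk : ∀ (j : (thetaIndex X).Label) (vQ : (thetaIndex X).VQ), Set ((logShellsDH X logv).Packet j vQ))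
  (archSub : ∀ (j : (thetaIndex X).Label) (v : (thetaIndex X).V),
    Set ((logShellsDH X logv).Packet j ((thetaIndex X).over v)))
  (Ψ : ℤ → ∀ v : (thetaIndex X).V, v ∈ (thetaIndex X).Vbad → Set ((logShellsDH X logv).StarPacket v))
  (act : ℤ → ∀ v : (thetaIndex X).V, v ∈ (thetaIndex X).Vbad →
    (logShellsDH X logv).StarPacket v → Module.End ℚ ((logShellsDH X logv).StarPacket v))
  (Mmod : ℤ → ∀ j : (thetaIndex X).LabelStar, Set ((logShellsDH X logv).GlobalPacket j.1))
  (region : ℤ → ∀ j : (thetaIndex X).LabelStar, FinDivisor M → ∀ vQ : (thetaIndex X).VQ,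
    Set ((logShellsDH X logv).Packet j.1 vQ))
  (frobAdm : ℤ → ℤ → ∀ (j : (thetaIndex X).Label) (vQ : (thetaIndex X).VQ),
    Set ((logShellsDH X logv).Packet j vQ) → Prop)
  (frobLogvol : ℤ → ℤ → ∀ (j : (thetaIndex X).Label) (vQ : (thetaIndex X).VQ),
    Set ((logShellsDH X logv).Packet j vQ) → ℝ)
  (frobΨ : ℤ → ℤ → ∀ v : (thetaIndex X).V, v ∈ (thetaIndex X).Vbad → Set ((logShellsDH X logv).StarPacket v))
  (frobMmod : ℤ → ℤ → ∀ j : (thetaIndex X).LabelStar, Set ((logShellsDH X logv).GlobalPacket j.1))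
  (unitImage : ℤ → ℤ → ℕ → ∀ (j : (thetaIndex X).Label) (vQ : (thetaIndex X).VQ),
    Set ((logShellsDH X logv).Packet j vQ))
  (ballImage : ℤ → ℤ → ∀ (j : (thetaIndex X).Label) (vQ : (thetaIndex X).VQ),
    Set ((logShellsDH X logv).Packet j vQ))
  (thetaDiv : ℤ → ℤ → LgpDivisor M (thetaIndex X).lstar)
  (n : ℤ) {HT : Type} {LogLink : HT → HT → Type} {IsFull : ∀ {s t : HT}, LogLink s t → Prop}
  (lat : LGPGaussianLogThetaLattice LogLink IsFull)
  {Frd : Type} {IsoF : Frd → Frd → Type} {Ob : Frd → Type} {realify : Frd → Frd} {Strip : Type}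
  {IsoS : Strip → Strip → Type} {Mv : ∀ v : (thetaIndex X).V, v ∈ (thetaIndex X).Vbad → Type}
  [∀ v h, Monoid (Mv v h)]
  (sig : GlobalLGPFrobenioidSignature (thetaIndex X).lstar (thetaIndex X).V (· ∈ (thetaIndex X).Vbad)
    Frd IsoF Ob realify Strip IsoS Mv)
  (split : SplittingMonoids Mv) {ObΔ : Type} {N : ∀ v : (thetaIndex X).V, v ∈ (thetaIndex X).Vbad → Type}
  [∀ v h, Monoid (N v h)] (qData : QPilotData ObΔ N)
  (t : ∀ (pp : Nat.Primes) (_ : Fin X.lstar) (x : (thetaIndex X).Fibre (.inr pp)),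
    haveI : Fact (pp : ℕ).Prime := ⟨pp.2⟩; kOf X pp.1 x)
  (tq : ∀ (pp : Nat.Primes) (x : (thetaIndex X).Fibre (.inr pp)), haveI : Fact (pp : ℕ).Prime := ⟨pp.2⟩; kOf X pp.1 x)
  (ρ : (∀ v : (thetaIndex X).V, v ∈ (thetaIndex X).Vbad → Set ((logShellsDH X logv).StarPacket v)) →
    ∀ (j : (thetaIndex X).Label) (vQ : (thetaIndex X).VQ), Set ((logShellsDH X logv).Packet j vQ))
  (qK : ∀ v : (thetaIndex X).V, v ∈ (thetaIndex X).Vbad → Set ((logShellsDH X logv).StarPacket v))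

/-- **Every global possible image of the Θ-pilot object at the genuine sharp bed has procession-normalised volume DIFFERENT from `−|log(q)|`**
(for Θ- and q-ideles realising `P_Θ`, `P_q`): it is `−deĝ̲_lgp(P_Θ)` (abc-iut-s2-p9 `processionNormalized_imageChoice_settingPrVolSharp`), while
`−|log(q)| = −deĝ̲(P_q)` (abc-iut-c312-7 `negLogQ_settingPrVolSharp`) and `−deĝ̲_lgp(P_Θ) < −deĝ̲(P_q)` (`neg_ndegLgp_thetaPilot_lt_neg_ndeg_qPilot`).
[cite: DupuyHilado2025, §3.4, Thm. 3.10.1] [cite: Mochizuki2012, IUTchIII Cor. 3.12 proof Step (x) p. 181] -/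
theorem processionNormalized_imageChoice_lt_negLogQ_settingPrVolSharp (ht0 : ∀ pp i x, t pp i x ≠ 0)
    (ht : ∀ (pp : Nat.Primes) (i : Fin X.lstar) (x : (thetaIndex X).Fibre (.inr pp)),
      haveI : Fact (pp : ℕ).Prime := ⟨pp.2⟩
      Real.log ‖t pp i x‖ = -(X.thetaPilot i (placeOf X pp.1 x)) * logNorm F (placeOf X pp.1 x) /
        localDegree F (placeOf X pp.1 x))
    (htq0 : ∀ pp x, tq pp x ≠ 0)
    (htq1 : ∀ (pp : Nat.Primes) (x : (thetaIndex X).Fibre (.inr pp)),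
      haveI : Fact (pp : ℕ).Prime := ⟨pp.2⟩; placeOf X pp.1 x ∉ X.S → ‖tq pp x‖ = 1)
    (htq : ∀ (pp : Nat.Primes) (x : (thetaIndex X).Fibre (.inr pp)),
      haveI : Fact (pp : ℕ).Prime := ⟨pp.2⟩
      Real.log ‖tq pp x‖ = -(X.qPilot (placeOf X pp.1 x)) * logNorm F (placeOf X pp.1 x) /
        localDegree F (placeOf X pp.1 x))
    (U : ImageChoice (settingPrVolSharp X hlog M archPk archSub Ψ act Mmod region n lat sig split qData tq t htq0 htq1)) :
    processionNormalized (fun i : Fin (thetaIndex X).lstar => ∑ᶠ vQ : (thetaIndex X).VQ,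
        ((situationPrVol X hlog M archPk archSub Ψ act Mmod region).D n).logvol (Setting.labelSucc i) vQ (U.1 (i, vQ))) <
      (settingPrVolSharp X hlog M archPk archSub Ψ act Mmod region n lat sig split qData tq t htq0 htq1).negLogQ := by
  rw [processionNormalized_imageChoice_settingPrVolSharp X hlog M archPk archSub Ψ act Mmod region n lat sig split qData tq t htq0
      htq1 ht0 ht U,
    negLogQ_settingPrVolSharp X hlog M archPk archSub Ψ act Mmod region n lat sig split qData t tq htq0 htq1 htq]
  exact neg_ndegLgp_thetaPilot_lt_neg_ndeg_qPilot X

/-- **(9-1) AS TYPED (`Repair.CandLana1.H`, row RP-L01 / RC-130) is FALSE at the genuine sharp bed with realising ideles**, for every region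
reading `ρ` and q-datum `qK` (which `H` does not read): no global possible image has procession-normalised volume `−|log(q)|`
(`processionNormalized_imageChoice_lt_negLogQ_settingPrVolSharp`). The genuine-bed twin of `CandLana1.not_H_pinned`; REFUTED-AS-TYPED at OUR
sharp setting (volume-preserving (Ind1)/(Ind2), (Ind3) absorbed in the sharp boxes) — not a statement about (9-1) in print, which its authors
record as open (§10.5 p. 49). [cite: LANA2026Report, §9.2 (9-1) p. 46] [cite: DupuyHilado2025, Thm. 3.10.1] -/
theorem not_H_settingPrVolSharp (ht0 : ∀ pp i x, t pp i x ≠ 0)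
    (ht : ∀ (pp : Nat.Primes) (i : Fin X.lstar) (x : (thetaIndex X).Fibre (.inr pp)),
      haveI : Fact (pp : ℕ).Prime := ⟨pp.2⟩
      Real.log ‖t pp i x‖ = -(X.thetaPilot i (placeOf X pp.1 x)) * logNorm F (placeOf X pp.1 x) /
        localDegree F (placeOf X pp.1 x))
    (htq0 : ∀ pp x, tq pp x ≠ 0)
    (htq1 : ∀ (pp : Nat.Primes) (x : (thetaIndex X).Fibre (.inr pp)),
      haveI : Fact (pp : ℕ).Prime := ⟨pp.2⟩; placeOf X pp.1 x ∉ X.S → ‖tq pp x‖ = 1)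
    (htq : ∀ (pp : Nat.Primes) (x : (thetaIndex X).Fibre (.inr pp)),
      haveI : Fact (pp : ℕ).Prime := ⟨pp.2⟩
      Real.log ‖tq pp x‖ = -(X.qPilot (placeOf X pp.1 x)) * logNorm F (placeOf X pp.1 x) /
        localDegree F (placeOf X pp.1 x)) :
    ¬ Repair.CandLana1.H
      (LatticeSituation.ofShells (logShellsDH X logv) M archPk archSub (summandPiecesPr X hlog).Adm
        (summandPiecesPr X hlog).logvol Ψ act Mmod region frobAdm frobLogvol frobΨ frobMmod unitImage ballImage thetaDiv)
      (settingPrVolSharp X hlog M archPk archSub Ψ act Mmod region n lat sig split qData tq t htq0 htq1) ρ qK := by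
  rintro ⟨U, hU⟩
  exact absurd hU (ne_of_lt (processionNormalized_imageChoice_lt_negLogQ_settingPrVolSharp X hlog M archPk archSub Ψ act Mmod
    region n lat sig split qData t tq ht0 ht htq0 htq1 htq U))

end Summit.ABC.IUTFork.Repair.RLana91GenuineBed

end
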